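import Literature.NumberTheory.EllipticCurves.Sprung2012.SharpFlatColemanKatoZeta
import HarnessLib

/-!
# Sprung 2012, Def. 7.12 + Thm. 7.14 (3) + Prop. 7.19 (with Def. 6.1, Props. 7.3/7.6 and Kato 2004
# Thm. 12.5/12.6): the ♯ AND the ♭ Coleman–Kato packages sit on ONE zeta submodule `𝐙(T) ⊂ 𝐇¹(T)` —
# the TWO-COLOUR reading of the held construction fact `thm714seq_sharpFlatColemanKato_zeta`

Topic `NumberTheory/EllipticCurves`, sub-directory `Sprung2012` (namespace = path). ONE new leaf file
(D-0064), imported by nobody at filing time. Cell `bsd-print-x8` (HOME `run/shared/lean/pub/bsd-print-x8/`),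
item (W-β) of the cell PLAN §2: asked BY NAME by the lead prover of crux item stmt-BirchSwinnertonDyer-19875
(`SprungLowerDivisibilityAtThree`, K1 of routes `SignedLowerHalves` / `PrintX8VS`), line
`chromatic-common-zeros` (`Cruxes/SprungLowerDivisibilityAtThree/PICKED.md`, 2026-08-28T04:57:32Z): its
registered skeleton carries the displayed hypothesis `hJ : JointColemanKatoZeta`
(`Cruxes/SprungLowerDivisibilityAtThree/Lines/chromatic_common_zeros.lean`, the `def JointColemanKatoZeta`),
a conjunct of the stub `stub_heldInputs`; this file types that Prop as a NAMED, page-cited Literature fact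
with the IDENTICAL binder telescope, so that `hJ` is discharged by the name below (`exact h` /
`Iff.rfl`-level identity of statements). HONEST FRAMING: statement-only (`def … : Prop`, D-0014); nothing is
asserted, no `_holds`; UNPROVED in Lean (Honda theory §2, Kato §§8–13, Poitou–Tate along the tower: none in
Mathlib; size XL); net debt +1 −0; BSD / K1 / no X8 cell is proved by anything here. No instance, no notation,
no attribute is declared or removed.

## What is typed, and the ONE sentence it adds over the held one-colour fact

`thm714seq_sharpFlatColemanKato_zeta` (this directory, `SharpFlatColemanKatoZeta.lean`, ACCEPTED p543968)
says: in the cyclotomic setting of [Sprung2012] Thm. 2.2 (binders verbatim below), for EVERY colour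
`• ∈ {♯, ♭}` and every pinned `I = 𝐇¹(T)^{η = 1}` the hypothesis structure
`SharpFlatColemanKatoData … • I` is inhabited — ONE COLOUR AT A TIME (`∀ col I, Nonempty (… col I)`), so the
zeta submodules `C♯.Z`, `C♭.Z ⊂ I.H` of two witnesses are not related by the typed statement. In print they
are THE SAME module: [Sprung2012] Def. 7.12 (p. 1503) defines `𝐙(T) :=` the `Λ`-submodule of `𝐇¹(T)`
generated by Kato's zeta elements ([Kato2004Asterisque] Thm. 12.5/12.6, Ex. 13.3) BEFORE and INDEPENDENTLY
of the choice `∗ ∈ {♯, ♭}`; Def. 6.1 (p. 1495) defines the PAIR `(L♯_p, L♭_p)` from `Col(z)` of ONE zeta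
element `z`; and the two four-term sequences (3) of Thm. 7.14 (p. 1504) / Prop. 7.19 (p. 1505),
`0 → 𝐇¹(T)^η/𝐙(T)^η → Λ/(L^∗_p) → 𝒳^∗ → 𝒳⁰ → 0` for `∗ = ♯` and `∗ = ♭`, START AT THE SAME TERM
`𝐇¹(T)^η/𝐙(T)^η`. The definition below is therefore the held fact with its last line
`∀ (col : Chroma) (I : …), Nonempty (SharpFlatColemanKatoData … col I)` replaced by the joint
`∀ (I : …), ∃ (Cs : … Chroma.sharp I) (Cf : … Chroma.flat I), Cs.Z = Cf.Z` — a CONSTRUCTION fact, weaker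
than print (the identity of the maps is forgotten up to the listed properties), never stronger. The
projection back to the one-colour fact is PROVED below (`thm714seq_sharpFlatColemanKato_zeta_of_joint`).
Reading flags inherited verbatim from the sister file (module docstring there): `Sp12-eta1-Ftower`,
`Sp12-61-eta1-ideal-localized`, `Sp12-714seq-eta1-maps-existential`, and the period register
`Sp12-716-period` (`ϖ` carried explicitly, `ϖ·Ω_E = Ω⁺_f`).

## Consumer (kernel, Summits side)

Line `chromatic-common-zeros`, stubs S1 `stub_squeezeToCommonZeros` (LANDED p606891: at a height-one
prime avoided by the Néron-normalised `L`-function of SOME colour `∘`, `Col^∘` injective gives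
`𝐇¹/Z ↪ Λ/Col^∘(Z)`, hence `length_𝔭(𝐇¹/Z) = 0`, and the four-term identity FOR THE OTHER COLOUR on the
SAME `Z` yields the local Eisenstein inequality — this cross-colour step is exactly where `Cs.Z = Cf.Z` is
used), S4/S5 `stub_cyclotomicLower`, and the conjunct `JointColemanKatoZeta` of S6 `stub_heldInputs`.

Page audit (R2-G44; text `paper:doi-10-1016-j-jnt-2011-11-003`, PDF page NN = printed 1482+NN; glyph
authority arXiv:1011.2485; locator table HOME/TY1-LOCATORS-SPRUNG2012-SHARPFLAT-COLEMAN-KATO.md; prior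
binder-by-binder audit of the identical telescope HOME/TY1-AUDIT-P543968-SHARPFLAT-COLEMAN-KATO-AT-THE-PAGE.md):
Def. 6.1 p. 1495 (p0013), Def. 7.12 p. 1503 (p0021), Thm. 7.14 with (3) p. 1504 (p0022), Prop. 7.19 p. 1505
(p0023), Props. 7.3/7.6 pp. 1500–1501 (p0018/p0019), Thm. 2.2 p. 1487.
-/

noncomputable section

open scoped MatrixGroups ModularForm NumberField

open CongruenceSubgroup WeierstrassCurve Field NumberField IsDedekindDomain
  Literature.NumberTheory.EllipticCurves Literature.NumberTheory.EllipticCurves.ModularForms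
  Literature.NumberTheory.GaloisRepresentations Literature.NumberTheory.EllipticCurves.Kato2004
  Literature.NumberTheory.EllipticCurves.Kato2004.EulerSystemValues ZpExtension
  Literature.NumberTheory.EllipticCurves.Sprung2017

namespace Literature.NumberTheory.EllipticCurves.Sprung2012

/-- **Sprung 2012, Def. 7.12 / Thm. 7.14 (3) / Prop. 7.19 (with Def. 6.1, Props. 7.3/7.6, Kato 2004
Thm. 12.5/12.6) — the JOINT ♯/♭ Coleman–Kato package on ONE zeta submodule** (construction fact, `Prop`;
UNPROVED in Lean; published theorem). For every elliptic curve `E/ℚ` (globally minimal model `W`; the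
Tate-module instances are BINDERS, as in `thm714seq_sharpFlatColemanKato_zeta` and the twin
`Kobayashi2003.thm62_63_73_signedColemanKato_zeta`), every ODD prime `p` of good reduction with `p ∣ a_p`
(supersingular, ANY `a_p` — in particular `(3, ±3)`), every newform `f` of `W` with period ratio `ϖ`
(`ϖ·Ω_E = Ω⁺_f`), the cyclotomic `ℤ_p`-extension `κ` with topological generator `γ` matching the cyclotomic
variable, the place `v ∣ p` with a local lift `g` of `γ` and a Honda system `(cneg, c)` (Thm. 2.2), and every
pinned `I : Kato2004.IwasawaH1Data W p κ γ` (`𝐇¹(T)^{η=1}`): there are a ♯-package `Cs` and a ♭-package `Cf`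
(`SharpFlatColemanKatoData … Chroma.sharp I`, `… Chroma.flat I`: Coleman map `ε_1 Col^• ∘ loc_p`,
injective when `L^• ≠ 0`; zeta submodule `Z ⊂ 𝐇¹(T)` inside the span of genuine Euler-system classes;
`Col^•(Z) = (ϖ·L^•_p(E))` on ideals localized at each height-one prime; the `Δ`-trivial component of the
four-term sequence (3) for every dual datum) WITH THE SAME ZETA SUBMODULE, `Cs.Z = Cf.Z` — in print
`𝐙(T)` (Def. 7.12) is defined with no reference to the colour and both sequences of Prop. 7.19 start at
`𝐇¹(T)^η/𝐙(T)^η`. The only content beyond `thm714seq_sharpFlatColemanKato_zeta` (implied back by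
`thm714seq_sharpFlatColemanKato_zeta_of_joint`) is that shared `Z`. Same binder telescope, letter for
letter, as the crux-line Prop `ChromaticCommonZeros.JointColemanKatoZeta`
(`Summits/…/Cruxes/SprungLowerDivisibilityAtThree/Lines/chromatic_common_zeros.lean`).

KEYING CAVEAT (recorded 2026-08-28; x8 dossier T67 (m) / T69 (d) / T72 (c), cell referee R-250 / R-275 / R-282,
director-bsd (266) R1′; TYPED ≠ PRINTED here — do not cite this constant as Sprung's theorem without the
involution). The packages `Cs`, `Cf` quantify (field `exact`) over dual data `D : SharpFlatSelmerDualData W κ γ …`,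
`Y : W.FineSelmerDualData κ γ` carrying the SAME key `γ` as Kato's covariant `I : Kato2004.IwasawaH1Data W p κ γ`
(`1 + T ↦ γ`, `IwasawaH1Data.proj_T_smul`). Under the tree's Pontryagin-dual convention
(`SharpFlatSelmerDualData.toDual_T_smul`, `WeierstrassCurve.FineSelmerDualData.toDual_T_smul`: `T` acts on a dual
by PRE-composition with `conj_γ`, i.e. by the contragredient action of `γ⁻¹`) the printed `X^•(E/ℚ_∞)`,
`X⁰(E/ℚ_∞)` of [Sprung2012] (3) p. 1504 — Pontryagin duals with their NATURAL `Λ`-action, about which (3),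
Prop. 7.19 and Thm. 7.16 are `Λ`-linear statements (cf. [Greenberg1989] pp. 101–102 `S^ι`; [Nekovar2006]
8.9.6.1–2, (9.1.4.2) and p. 263; [PerrinRiou1995Asterisque] §2.5.1, A.3.2) — are the data of key `γ⁻¹`. So
this statement is the printed one composed with the Iwasawa involution `ι` (`γ ↦ γ⁻¹`) out of `Λ`: it agrees
with print iff the ideals `colMap(𝐇¹) ⊆ Λ` concerned are `ι`-symmetric prime by prime — true up to units at
`a_p = 0` (`Sprung2017.cor414_sharpFlat_functionalEquation_apZero_holds`), unprinted at `(p, a_p) = (3, ±3)`.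
The PRINT-KEYED transcription (duals of key `γ⁻¹`, covariant side unchanged) is
`thm714seq_sharpFlatColemanKato_zetaJoint_contra` in `Sprung2012/SharpFlatColemanKatoContragredient.lean`, whose
module docstring spells the comparison out; the kernel dictionary between the two keyings is
`Sprung2012/SharpFlatSelmerDualInvolutionTwistProofs.lean` (`sharpFlatSelmerDualData_mem_charIdeal_inv_iff`,
`…_lengthAt_inv_eq`). Problem-side, `Summit.BirchSwinnertonDyer.BirchSwinnertonDyer.Theorems.ChromaticKeying.
not_thm714seq_sharpFlatColemanKato_zetaJoint_of_printedKato_of_coprimeCell_flatZero` derives the NEGATION of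
this statement from the print-keyed facts `thm714_sharpFlatSelmerDual_finite_torsion`,
`thm716_sharpFlatCharIdeal_divisibility_contra`, `realPeriodRat_eq_unit_mul_plusPeriod_three`, modularity
(`ModularForms.exists_isNewformOf`) and ONE X8 cell datum (a curve of the class `(3, a₃ = ±3)` whose normalised
♯/♭ pair has no common zero and whose `L♭` has `μ = 0`, `λ ≥ 1`, `L♭(0) ≠ 0` — observed numerically on 119 of
142 rank-0 cells of the x8 census, none kernel-certified). Kept unchanged for its consumers (route items that
bind it by name); a print-keyed consumer should bind the `_contra` sibling.
[cite: Sprung2012, Def. 6.1 (p. 1495), Prop. 7.3 (p. 1500), Prop. 7.6 (p. 1501), Def. 7.12 (p. 1503), Thm. 7.14 with (3) (p. 1504), Prop. 7.19 (p. 1505), Thm. 2.2 (p. 1487)]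
[cite: Kato2004Asterisque, Thm. 12.5 and Thm. 12.6 (p. 222), Ex. 13.3 (p. 225)]
[cite: Kobayashi2003, Thm. 5.1 iii), Thm. 5.2 iv), Remark 5.3 i) (pp. 9–10)] -/
def thm714seq_sharpFlatColemanKato_zetaJoint : Prop :=
  ∀ (W : WeierstrassCurve ℚ) [W.IsElliptic] [W.IsGloballyMinimal] (p : ℕ) [Fact p.Prime]
    [ContinuousSMul ℤ_[p] (W.tateModule p)] [Module.Free ℤ_[p] (W.tateModule p)]
    [Module.Finite ℤ_[p] (W.tateModule p)] {N : ℕ} [NeZero N] (f : CuspForm (Gamma0 N) 2) (ϖ : ℚ)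
    (κ : ZpExtension ℚ p) (γ : absoluteGaloisGroup ℚ),
    p ≠ 2 → W.HasGoodReductionAtPrime p → (p : ℤ) ∣ W.frobeniusTrace p → IsNewformOf W f →
    (ϖ : ℝ) * W.realPeriodRat = plusPeriod f →
    κ.IsCyclotomic → κ.IsTopGenerator γ → IsCyclotomicVariable p γ →
    ∀ (v : HeightOneSpectrum (𝓞 ℚ)), (p : 𝓞 ℚ) ∈ v.asIdeal →
    ∀ (g : absoluteGaloisGroup (v.adicCompletion ℚ)),
      κ.IsTopGenerator (resGalOfEmb (closureEmb (K := ℚ) (v.adicCompletion ℚ)) g) →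
    ∀ (cneg : localPoints W (v.adicCompletion ℚ)) (c : ℕ → localPoints W (v.adicCompletion ℚ)),
      IsHondaSystem κ (closureEmb (K := ℚ) (v.adicCompletion ℚ)) W (W.frobeniusTrace p) g cneg c →
    ∀ (I : Kato2004.IwasawaH1Data W p κ γ),
      ∃ (Cs : SharpFlatColemanKatoData W p f ϖ κ γ (closureEmb (K := ℚ) (v.adicCompletion ℚ))
            (W.frobeniusTrace p) g c Chroma.sharp I)
        (Cf : SharpFlatColemanKatoData W p f ϖ κ γ (closureEmb (K := ℚ) (v.adicCompletion ℚ))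
            (W.frobeniusTrace p) g c Chroma.flat I),
        Cs.Z = Cf.Z

/-- **Projection to the held one-colour fact** (PROVED): the joint package gives, colour by colour, an
inhabitant of `SharpFlatColemanKatoData … col I` — i.e. `thm714seq_sharpFlatColemanKato_zeta` (the statement of
route item stmt-BirchSwinnertonDyer-20772 `InputSharpFlatColemanKatoZeta` of `PrintX8VS`) follows from the joint
reading by forgetting `Cs.Z = Cf.Z` — colour by colour this is the per-colour package of Thm. 7.14's exact
sequence (3) with Def. 6.1 / Def. 7.12.
[cite: Sprung2012, Def. 7.12 (p. 1503), Thm. 7.14 with (3) (p. 1504), Prop. 7.19 (p. 1505)] -/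
theorem thm714seq_sharpFlatColemanKato_zeta_of_joint (h : thm714seq_sharpFlatColemanKato_zetaJoint) :
    thm714seq_sharpFlatColemanKato_zeta := by
  intro W _ _ p _ _ _ _ N _ f ϖ κ γ hp hgood hap hf hϖ hκ hγ hcv v hv g hg cneg c hH col I
  obtain ⟨Cs, Cf, _⟩ := h W p f ϖ κ γ hp hgood hap hf hϖ hκ hγ hcv v hv g hg cneg c hH I
  cases col with
  | sharp => exact ⟨Cs⟩
  | flat => exact ⟨Cf⟩

end Literature.NumberTheory.EllipticCurves.Sprung2012

end
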